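import Literature.Computability.Complexity.AdditiveRealClasses
import Literature.Computability.Complexity.FKPointLocationCertificates
import Literature.Computability.Complexity.OracleComposition
import Mathlib.Algebra.BigOperators.Fin
import HarnessLib

/-!
# Fournier–Koiran transfer, oracle glue: bounded queries, agreeing sign oracles, equal runs

Topic `Literature/Computability/Complexity`, grouping namespace `FKPointLocation`. The step from
point location to Fournier–Koiran's Theorem 3 (ICALP 2000 = LIP RR-1999-21, p. 11: "a point of the
located set decides membership like `x`") in the sign-oracle rendering of
`AdditiveRealClasses.lean`:

* `runAux_eq_of_agree_oneBit` — two one-bit oracles that agree on every query the machine can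
  ask along one-bit transcripts of bounded length give the same run;
* `natAbs_of_decode_listBool_lt` — every integer decoded from a sign query `q` has absolute value
  `< 2^{|q|+1}` (all decoders of the tree's codes are total; `decodeNat` stays below `2^{|w|+1}`);
  `exists_query_length_bound` — the queries of a polynomial-time oracle algorithm on the inputs
  `⟨1ⁿ, y⟩`, `|y| ≤ q(n)`, within `q(n)` one-bit rounds have length `≤ T(n)` for a polynomial `T`
  (Remark 1 of the report: tests of a time-`t(n)` machine have coefficients `≤ 2^{t(n)}`);
* `signOracle_eq_of_sign_agree` — if the affine forms with coefficients bounded by `B` have the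
  same sign at `x` and at `x'` then the two sign oracles agree on every query whose decoded
  integers are bounded by `B`;
* `affine_sign_agree_of_homogeneous` — de-homogenisation: from a point `X ∈ ℚ^{n+1}` in the same
  face as `x̂ = (x, 1)` for all INTEGER LINEAR forms bounded by `B ≥ 1` (the conclusion of
  `Cert.sign_lin_xStar_eq`), the rational point `x* = X_{<n}/X_n` has `sign h(x*) = sign h(x)` for
  all affine `h` with coefficients bounded by `B` (report §2.3: "Proposition 1 will follow by
  setting `x_{n+1} = 1`").

## References

* H. Fournier, P. Koiran, *Lower bounds are not easier over the reals: inside PH*, ICALP 2000,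
  LNCS 1853 = LIP RR-1999-21, §2 Remark 1, §2.3, Thm 3 (p. 11). [FournierKoiran2000]
-/

namespace Literature.Computability.Complexity

namespace FKPointLocation

open _root_.Computability Finset

/-! ### Equal runs from agreeing one-bit oracles -/

/-- **Agreeing one-bit oracles give equal runs.** If `O` answers with one bit and `O`, `O'` agree
on every query that `M` asks after a one-bit transcript of length `< K`, then the runs of `M` from
one-bit transcripts agree as long as transcript length plus fuel stays `≤ K`. [folklore] -/
theorem runAux_eq_of_agree_oneBit {β : Type} (M : OracleAlg β) {O O' : Oracle}
    (hO1 : ∀ w, (O w).length = 1) (x : List Bool) (K : ℕ)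
    (hagree : ∀ ans : List (List Bool), (∀ a ∈ ans, a.length = 1) → ans.length < K →
      ∀ q, M.step x ans = Sum.inl q → O q = O' q) :
    ∀ k (ans : List (List Bool)), (∀ a ∈ ans, a.length = 1) → ans.length + k ≤ K →
      M.runAux O x k ans = M.runAux O' x k ans := by
  intro k
  induction k with
  | zero => intro ans _ _; rfl
  | succ k ih =>
    intro ans hans hk
    rw [OracleAlg.runAux_succ, OracleAlg.runAux_succ]
    cases hstep : M.step x ans with
    | inl q =>
      simp only
      rw [← hagree ans hans (by omega) q hstep]
      exact ih (ans ++ [O q]) (fun a ha => by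
        rcases List.mem_append.1 ha with h | h
        · exact hans a h
        · simp only [List.mem_singleton] at h; subst h; exact hO1 q) (by simp; omega)
    | inr b => rfl

/-! ### Decoded integers are short -/

/-- Mathlib's positive-numeral decoder stays below `2^{|l|+1}`. [folklore] -/
theorem decodePosNum_lt_two_pow_succ' : ∀ l : List Bool, ((decodePosNum l : PosNum) : ℕ) < 2 ^ (l.length + 1)
  | [] => by simp [decodePosNum]
  | false :: l => by
    have ih := decodePosNum_lt_two_pow_succ' l
    rw [decodePosNum, PosNum.cast_bit0, List.length_cons, pow_succ]
    omega
  | true :: l => by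
    have ih := decodePosNum_lt_two_pow_succ' l
    rw [decodePosNum]
    split_ifs with h
    · simp
    · rw [PosNum.cast_bit1, List.length_cons, pow_succ]
      omega

/-- `decodeNat w < 2^{|w|+1}`. [folklore] -/
theorem decodeNat_lt_two_pow_succ' (w : List Bool) : decodeNat w < 2 ^ (w.length + 1) := by
  unfold decodeNat decodeNum
  split_ifs with h
  · exact Nat.pos_of_ne_zero (by positivity)
  · rw [PosNum.cast_to_num, Num.cast_pos]
    exact decodePosNum_lt_two_pow_succ' w

/-- An integer decoded from `w` has absolute value `< 2^{|w|+1}`. [folklore] -/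
theorem natAbs_of_decode_int_lt (w : List Bool) (z : ℤ) (h : encodingIntBool.decode w = some z) :
    z.natAbs < 2 ^ (w.length + 1) := by
  have hlen := length_boolUnpair_parts_le w
  have hdec : encodingIntBool.decode w =
      some (if decodeBool (boolUnpair w).1 then -((decodeNat (boolUnpair w).2 : ℕ) : ℤ)
        else ((decodeNat (boolUnpair w).2 : ℕ) : ℤ)) := rfl
  rw [hdec, Option.some.injEq] at h
  subst h
  have hm : decodeNat (boolUnpair w).2 < 2 ^ ((boolUnpair w).2.length + 1) := decodeNat_lt_two_pow_succ' _
  have hmono : 2 ^ ((boolUnpair w).2.length + 1) ≤ 2 ^ (w.length + 1) :=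
    Nat.pow_le_pow_right (by norm_num) (by omega)
  split_ifs <;> simpa using lt_of_lt_of_le hm hmono

/-- Items produced by the fuelled list decoder are decodes of pieces of the string. [folklore] -/
theorem natAbs_of_listBoolDecode_lt : ∀ (fuel : ℕ) (w : List Bool) (l : List ℤ),
    listBoolDecode encodingIntBool fuel w = some l → ∀ z ∈ l, z.natAbs < 2 ^ (w.length + 1)
  | 0, w, l, h, z, hz => by
    simp [listBoolDecode] at h; subst h; simp at hz
  | fuel + 1, w, l, h, z, hz => by
    have hlen := length_boolUnpair_parts_le w
    simp only [listBoolDecode, Option.bind_eq_bind, Option.bind_eq_some_iff] at h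
    obtain ⟨a, ha, l', hl', hret⟩ := h
    simp only [Option.pure_def, Option.some.injEq] at hret
    subst hret
    rcases List.mem_cons.1 hz with rfl | hz'
    · exact lt_of_lt_of_le (natAbs_of_decode_int_lt _ _ ha) (Nat.pow_le_pow_right (by norm_num) (by omega))
    · exact lt_of_lt_of_le (natAbs_of_listBoolDecode_lt fuel _ l' hl' z hz')
        (Nat.pow_le_pow_right (by norm_num) (by omega))

/-- **Every integer decoded from a sign query `q` is `< 2^{|q|+1}` in absolute value.**
[cite: FournierKoiran2000, §2 Remark 1 (tests of a time-`q(n)` program have coefficients bounded by `2^{q(n)}`)] -/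
theorem natAbs_of_decode_listBool_lt (q : List Bool) (l : List ℤ)
    (h : (encodingIntBool.listBool).decode q = some l) : ∀ z ∈ l, z.natAbs < 2 ^ (q.length + 1) := by
  intro z hz
  have hlen := length_boolUnpair_parts_le q
  have := natAbs_of_listBoolDecode_lt _ _ l h z hz
  exact lt_of_lt_of_le this (Nat.pow_le_pow_right (by norm_num) (by omega))

/-- `getD` of a decoded list is bounded too (default `0`). [folklore] -/
theorem natAbs_getD_of_decode_listBool_le (q : List Bool) (l : List ℤ)
    (h : (encodingIntBool.listBool).decode q = some l) (i : ℕ) : (l.getD i 0).natAbs < 2 ^ (q.length + 1) := by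
  rw [List.getD_eq_getElem?_getD]
  cases hget : l[i]? with
  | none => simp
  | some z => simpa using natAbs_of_decode_listBool_lt q l h z (List.mem_of_getElem? hget)

/-! ### Query length of a polynomial-time oracle algorithm along one-bit transcripts -/

/-- Length of a unary numeral. [folklore] -/
theorem length_unaryEncodeNat' : ∀ n : ℕ, (unaryEncodeNat n).length = n
  | 0 => rfl
  | n + 1 => by rw [unaryEncodeNat, List.length_cons, length_unaryEncodeNat' n]

/-- Length of the list code of a one-bit transcript. [folklore] -/
theorem length_listBool_encode_oneBit (ans : List (List Bool)) (h : ∀ a ∈ ans, a.length = 1) :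
    ((encodingList Bool).listBool.encode ans).length = 6 * ans.length + 2 := by
  have hbody : ∀ (as : List (List Bool)), (∀ a ∈ as, a.length = 1) →
      (as.foldr (fun a acc => boolPair ((encodingList Bool).encode a) acc) []).length = 4 * as.length := by
    intro as has
    induction as with
    | nil => rfl
    | cons a as ih =>
      rw [List.foldr_cons, length_boolPair, ih (fun a' ha' => has a' (List.mem_cons_of_mem _ ha'))]
      have : ((encodingList Bool).encode a).length = 1 := has a List.mem_cons_self
      rw [this, List.length_cons]; ring
  change (boolPair (unaryEncodeNat ans.length) _).length = _
  rw [length_boolPair, hbody ans h, length_unaryEncodeNat']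
  ring

/-- **The queries of a polynomial-time oracle algorithm are polynomially short**: on inputs
`⟨1ⁿ, y⟩` with `|y| ≤ q(n)`, after any one-bit transcript of length `≤ q(n)`, the next query has
length `≤ T(n)`. [cite: FournierKoiran2000, §2 Remark 1] -/
theorem exists_query_length_bound (M : OracleAlg Bool) (hM : M.IsPolyTime encodingBoolBool) (q : Polynomial ℕ) :
    ∃ T : Polynomial ℕ, ∀ (n : ℕ) (y : List Bool), y.length ≤ q.eval n →
      ∀ ans : List (List Bool), (∀ a ∈ ans, a.length = 1) → ans.length ≤ q.eval n →
        ∀ qry, M.step (boolPair (unaryEncodeNat n) y) ans = Sum.inl qry → qry.length ≤ T.eval n := by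
  obtain ⟨R, hR⟩ := hM.exists_length_le
  refine ⟨R.comp (Polynomial.C 4 * Polynomial.X + Polynomial.C 8 * q + Polynomial.C 8), fun n y hy ans hans hlen qry hq => ?_⟩
  have h := hR (boolPair (unaryEncodeNat n) y) ans
  rw [hq] at h
  have hcode : (((encodingList Bool).sumBool encodingBoolBool).encode (Sum.inl qry : List Bool ⊕ Bool)).length = qry.length + 1 := by
    simp [Encoding.sumBool, encodingList]
  rw [hcode] at h
  have hinput : (boolPair (boolPair (unaryEncodeNat n) y) ((encodingList Bool).listBool.encode ans)).length ≤
      4 * n + 8 * q.eval n + 8 := by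
    rw [length_boolPair, length_boolPair, length_listBool_encode_oneBit ans hans, length_unaryEncodeNat']
    omega
  have := TM2Iter.eval_mono R hinput
  rw [Polynomial.eval_comp]
  simp only [Polynomial.eval_add, Polynomial.eval_mul, Polynomial.eval_C, Polynomial.eval_X]
  omega

/-! ### Agreeing sign oracles -/

/-- The value of a sign query at a point, through the decoded list. [folklore] -/
theorem affineQueryValue_of_decode {n : ℕ} (x : Fin n → ℝ) (qry : List Bool) (l : List ℤ)
    (h : (encodingIntBool.listBool).decode qry = some l) :
    affineQueryValue x qry = ((l.getD 0 0 : ℤ) : ℝ) + ∑ i : Fin n, ((l.getD (i.val + 1) 0 : ℤ) : ℝ) * x i := by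
  simp [affineQueryValue, h]

/-- The list decoder of sign queries is total. [folklore] -/
theorem decode_listBool_isSome (qry : List Bool) : ∃ l, (encodingIntBool.listBool).decode qry = some l := by
  have key : ∀ (fuel : ℕ) (w : List Bool), ∃ l, listBoolDecode encodingIntBool fuel w = some l := by
    intro fuel
    induction fuel with
    | zero => intro w; exact ⟨[], rfl⟩
    | succ fuel ih =>
      intro w
      obtain ⟨l, hl⟩ := ih (boolUnpair w).2
      have hint : ∃ z, encodingIntBool.decode (boolUnpair w).1 = some z := by
        simp [encodingIntBool, Encoding.pairBool, encodingBoolBool, encodingNatBool]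
      obtain ⟨z, hz⟩ := hint
      exact ⟨z :: l, by simp [listBoolDecode, hz, hl]⟩
  exact key _ _

/-- **Sign agreement on bounded affine forms gives equal sign oracles on bounded queries.**
[cite: FournierKoiran2000, Thm 3 p. 11 ("running `T` on `⟨q, z⟩`" for a rational point `q` of the face)] -/
theorem signOracle_eq_of_sign_agree {n : ℕ} (x x' : Fin n → ℝ) (B : ℕ)
    (hsign : ∀ (a : Fin n → ℤ) (c : ℤ), (∀ i, (a i).natAbs ≤ B) → c.natAbs ≤ B →
      SignType.sign ((c : ℝ) + ∑ i, (a i : ℝ) * x i) = SignType.sign ((c : ℝ) + ∑ i, (a i : ℝ) * x' i))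
    (qry : List Bool) (hq : ∀ l, (encodingIntBool.listBool).decode qry = some l → ∀ z ∈ l, z.natAbs ≤ B) :
    signOracle x qry = signOracle x' qry := by
  obtain ⟨l, hl⟩ := decode_listBool_isSome qry
  have hb : ∀ i, (l.getD i 0).natAbs ≤ B := by
    intro i
    rw [List.getD_eq_getElem?_getD]
    cases hget : l[i]? with
    | none => simp
    | some z => simpa using hq l hl z (List.mem_of_getElem? hget)
  rw [signOracle_apply, signOracle_apply, affineQueryValue_of_decode x qry l hl, affineQueryValue_of_decode x' qry l hl]
  have h := hsign (fun i => l.getD (i.val + 1) 0) (l.getD 0 0) (fun i => hb _) (hb 0)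
  congr 1
  -- equal signs give equal bits
  set u := ((l.getD 0 0 : ℤ) : ℝ) + ∑ i : Fin n, ((l.getD (i.val + 1) 0 : ℤ) : ℝ) * x i
  set v := ((l.getD 0 0 : ℤ) : ℝ) + ∑ i : Fin n, ((l.getD (i.val + 1) 0 : ℤ) : ℝ) * x' i
  change SignType.sign u = SignType.sign v at h
  rcases lt_trichotomy u 0 with hu | hu | hu
  · rw [sign_neg hu] at h
    have hv : v < 0 := sign_eq_neg_one_iff.1 h.symm
    rw [decide_eq_false (not_le.2 hu), decide_eq_false (not_le.2 hv)]
  · rw [hu, sign_zero] at h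
    have hv : v = 0 := sign_eq_zero_iff.1 h.symm
    rw [hu, hv]
  · rw [sign_pos hu] at h
    have hv : 0 < v := sign_eq_one_iff.1 h.symm
    rw [decide_eq_true hu.le, decide_eq_true hv.le]

/-! ### De-homogenisation -/

/-- The homogenisation `x̂ = (x, 1)` of a point. [cite: FournierKoiran2000, §2.3] -/
def hat {n : ℕ} (x : Fin n → ℝ) : Fin (n + 1) → ℝ := Fin.snoc x 1

/-- `lin (snoc a c) (hat x) = c + ∑ aᵢ xᵢ`. [cite: FournierKoiran2000, §2.3 ("setting `x_{n+1} = 1`")] -/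
theorem lin_snoc_hat {n : ℕ} (a : Fin n → ℤ) (c : ℤ) (x : Fin n → ℝ) :
    lin (Fin.snoc a c : Fin (n + 1) → ℤ) (hat x) = (c : ℝ) + ∑ i, (a i : ℝ) * x i := by
  rw [lin, Fin.sum_univ_castSucc]
  simp [hat, Fin.snoc_castSucc, Fin.snoc_last, add_comm]

/-- `lin (snoc a c) X = X_last · (c + ∑ aᵢ Xᵢ/X_last)` for `X_last ≠ 0`. [folklore] -/
theorem lin_snoc_eq_mul {n : ℕ} (a : Fin n → ℤ) (c : ℤ) (X : Fin (n + 1) → ℝ) (hX : X (Fin.last n) ≠ 0) :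
    lin (Fin.snoc a c : Fin (n + 1) → ℤ) X =
      X (Fin.last n) * ((c : ℝ) + ∑ i : Fin n, (a i : ℝ) * (X i.castSucc / X (Fin.last n))) := by
  rw [lin, Fin.sum_univ_castSucc]
  simp only [Fin.snoc_castSucc, Fin.snoc_last, mul_add, Finset.mul_sum]
  rw [add_comm]
  congr 1
  · ring
  · exact Finset.sum_congr rfl fun i _ => by field_simp

/-- **De-homogenisation.** If `X ∈ ℝ^{n+1}` has, for every integer LINEAR form with `|a|_∞ ≤ B`
(`B ≥ 1`), the same sign as `x̂ = (x, 1)`, then `X_last > 0` and the point `x* = X_{<n}/X_last`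
has, for every integer AFFINE form with coefficients bounded by `B`, the same sign as `x`.
[cite: FournierKoiran2000, §2.3 and Thm 3 p. 11] -/
theorem affine_sign_agree_of_homogeneous {n : ℕ} (x : Fin n → ℝ) (X : Fin (n + 1) → ℝ) {B : ℕ} (hB : 1 ≤ B)
    (h : ∀ a : Fin (n + 1) → ℤ, (∀ i, (a i).natAbs ≤ B) → SignType.sign (lin a X) = SignType.sign (lin a (hat x))) :
    0 < X (Fin.last n) ∧
    ∀ (a : Fin n → ℤ) (c : ℤ), (∀ i, (a i).natAbs ≤ B) → c.natAbs ≤ B →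
      SignType.sign ((c : ℝ) + ∑ i, (a i : ℝ) * x i) =
        SignType.sign ((c : ℝ) + ∑ i, (a i : ℝ) * (X i.castSucc / X (Fin.last n))) := by
  -- the last coordinate form
  have hlast : 0 < X (Fin.last n) := by
    have h1 := h (Fin.snoc (0 : Fin n → ℤ) 1) (fun i => by
      refine Fin.lastCases ?_ (fun j => ?_) i
      · simp [hB]
      · simp)
    rw [lin_snoc_hat] at h1
    simp only [Pi.zero_apply, Int.cast_zero, zero_mul, Finset.sum_const_zero, add_zero, Int.cast_one, sign_one] at h1
    have h2 : lin (Fin.snoc (0 : Fin n → ℤ) 1 : Fin (n + 1) → ℤ) X = X (Fin.last n) := by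
      rw [lin, Fin.sum_univ_castSucc]; simp
    rw [h2] at h1
    exact sign_eq_one_iff.1 h1
  refine ⟨hlast, fun a c ha hc => ?_⟩
  have h1 := h (Fin.snoc a c) (fun i => by
    refine Fin.lastCases ?_ (fun j => ?_) i
    · simpa using hc
    · simpa using ha j)
  rw [lin_snoc_hat, lin_snoc_eq_mul a c X hlast.ne', sign_mul, sign_pos hlast, one_mul] at h1
  exact h1.symm

end FKPointLocation

end Literature.Computability.Complexity
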